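import Summits.NavierStokesRegularity.NavierStokesRegularity.Theorems.HarmonicShellLaplacian
import HarnessLib

/-!
# HarmonicShellCalculus — plate S «ShellCalculus» of ROUND-41 «IsotropicBlobPressureLaw»
# (first and second derivatives of a shell `‖·‖^α h` off the origin)

The derivative side of `HarmonicShellLaplacian` (E0–E2), on `EuclideanSpace ℝ (Fin 3)`, for use by the
sphere-glue plate G (`IsotropicBlobSphereGlue.contDiff_two_sphereGlue`: matchings of values, first and
second derivatives on a sphere) and by E2 in the exterior (sums of multipoles are `C²` off the origin):

* (S1) `hasFDerivAt_norm_rpow_mul`, `fderiv_norm_rpow_mul_apply`: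
  `D(‖·‖^α h)(x) v = ‖x‖^α·Dh(x) v + α‖x‖^{α−2} h(x)⟪x,v⟫` at `x ≠ 0`;
* (S2) `contDiffAt_norm_rpow_mul` (`x ≠ 0`, any order) and `contDiff_norm_pow_mul` (even powers, everywhere);
* (S3) `fderiv_fderiv_norm_rpow_mul_apply`: for `h` of class `C²` at `x ≠ 0`,
  `D²(‖·‖^α h)(x)(v)(w) = ‖x‖^α D²h(x)(v)(w) + α‖x‖^{α−2}(⟪x,v⟫Dh(x) w + ⟪x,w⟫Dh(x) v + h(x)⟪v,w⟫)
   + α(α−2)‖x‖^{α−4} h(x)⟪x,v⟫⟪x,w⟫`;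
* (S4) finite sums of shells `Σ_k c_k ‖·‖^{α_k} h_k` at `x ≠ 0`: `laplacian_finset_sum_apply` /
  `laplacian_sum_norm_rpow_mul` (Δ), `fderiv_sum_norm_rpow_mul_apply` (D), `fderiv_fderiv_finset_sum_apply` /
  `fderiv_fderiv_sum_norm_rpow_mul_apply` (D²) — interior Fischer shells `α_k = 2j_k+2` and exterior Kelvin
  multipoles `α_k = −(2l_k+1)` are both instances.

Everything proved; no definitions, no named facts; `--supports stmt-NavierStokesRegularity-0056 --as helper`
(typed by ns-s29-p2 g5 for the LEAD S-door ns-s30-p1 g4 / nsreg-p1 g33). [folklore]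

HONEST FRAME: generic calculus plates for a kinematic slice law calibrating the S40/S41 clock doors; items 0056
`NoTypeII`, 10661 and NS regularity are NOT proved; nothing here is a route or a summit statement.
-/

noncomputable section

open Set Filter InnerProductSpace
open scoped Laplacian RealInnerProductSpace Topology ContDiff

set_option linter.dupNamespace false

namespace Summit.NavierStokesRegularity.NavierStokesRegularity.Theorems.StrainDoors.HarmonicShell

/-! ## (S1) First derivative of a shell -/

/-- The radial factor `‖·‖^α` has derivative `α‖x‖^{α−2}⟪x,·⟫` at `x ≠ 0`. [folklore] -/
theorem hasFDerivAt_norm_rpow {x : EuclideanSpace ℝ (Fin 3)} (hx : x ≠ 0) (α : ℝ) :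
    HasFDerivAt (fun y : EuclideanSpace ℝ (Fin 3) => ‖y‖ ^ α)
      ((α * ‖x‖ ^ (α - 2)) • (innerSL ℝ x : EuclideanSpace ℝ (Fin 3) →L[ℝ] ℝ)) x := by
  have hs : 0 < ‖x‖ ^ 2 := by positivity
  have hfun : (fun y : EuclideanSpace ℝ (Fin 3) => ‖y‖ ^ α) = fun y => (‖y‖ ^ 2) ^ (α / 2) := by
    funext y
    rw [norm_sq_rpow, show 2 * (α / 2) = α by ring]
  have hg : HasDerivAt (fun τ : ℝ => τ ^ (α / 2)) (α / 2 * (‖x‖ ^ 2) ^ (α / 2 - 1)) (‖x‖ ^ 2) :=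
    Literature.Analysis.PDE.LoewnerNirenberg.hasDerivAt_rpow_const_of_pos (α / 2) (α / 2 - 1) rfl hs
  have h := Literature.Analysis.FluidPDE.hasFDerivAt_comp_norm_sq (E := EuclideanSpace ℝ (Fin 3)) hg
  rw [hfun]
  refine h.congr_fderiv ?_
  rw [norm_sq_rpow, show 2 * (α / 2 - 1) = α - 2 by ring]
  congr 1
  ring

/-- **(S1)** The shell `‖·‖^α h` has derivative `‖x‖^α • Dh(x) + α‖x‖^{α−2}h(x) • ⟪x,·⟫` at `x ≠ 0`.
[folklore] -/
theorem hasFDerivAt_norm_rpow_mul (α : ℝ) {h : EuclideanSpace ℝ (Fin 3) → ℝ}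
    {h' : EuclideanSpace ℝ (Fin 3) →L[ℝ] ℝ} {x : EuclideanSpace ℝ (Fin 3)} (hx : x ≠ 0)
    (hh : HasFDerivAt h h' x) :
    HasFDerivAt (fun y => ‖y‖ ^ α * h y)
      ((‖x‖ ^ α) • h' + (α * ‖x‖ ^ (α - 2) * h x) •
        (innerSL ℝ x : EuclideanSpace ℝ (Fin 3) →L[ℝ] ℝ)) x := by
  have hd := (hasFDerivAt_norm_rpow hx α).fun_mul hh
  exact hd.congr_fderiv (by rw [smul_smul, mul_comm (h x) (α * ‖x‖ ^ (α - 2))])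

/-- **(S1, applied form)** `D(‖·‖^α h)(x) v = ‖x‖^α·Dh(x) v + α‖x‖^{α−2} h(x)⟪x,v⟫` at `x ≠ 0`, for `h`
differentiable at `x`. [folklore] -/
theorem fderiv_norm_rpow_mul_apply (α : ℝ) {h : EuclideanSpace ℝ (Fin 3) → ℝ} {x : EuclideanSpace ℝ (Fin 3)}
    (hx : x ≠ 0) (hh : DifferentiableAt ℝ h x) (v : EuclideanSpace ℝ (Fin 3)) :
    fderiv ℝ (fun y => ‖y‖ ^ α * h y) x v = ‖x‖ ^ α * fderiv ℝ h x v + α * ‖x‖ ^ (α - 2) * h x * ⟪x, v⟫ := by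
  rw [(hasFDerivAt_norm_rpow_mul α hx hh.hasFDerivAt).fderiv]
  simp [smul_eq_mul]

/-! ## (S2) Smoothness of shells -/

/-- **(S2)** A shell `‖·‖^α h` is `C^n` at `x ≠ 0` when `h` is. [folklore] -/
theorem contDiffAt_norm_rpow_mul (α : ℝ) {n : WithTop ℕ∞} {h : EuclideanSpace ℝ (Fin 3) → ℝ}
    {x : EuclideanSpace ℝ (Fin 3)} (hx : x ≠ 0) (hh : ContDiffAt ℝ n h x) :
    ContDiffAt ℝ n (fun y => ‖y‖ ^ α * h y) x := by
  have hs : 0 < ‖x‖ ^ 2 := by positivity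
  have hfun : (fun y : EuclideanSpace ℝ (Fin 3) => ‖y‖ ^ α * h y) = fun y => (‖y‖ ^ 2) ^ (α / 2) * h y := by
    funext y
    rw [norm_sq_rpow, show 2 * (α / 2) = α by ring]
  rw [hfun]
  exact ((contDiff_norm_sq ℝ).contDiffAt.rpow_const_of_ne hs.ne').mul hh

/-- **(S2′)** An even shell `‖·‖^{2j+2} h` is `C^n` everywhere when `h` is. [folklore] -/
theorem contDiff_norm_pow_mul (j : ℕ) {n : WithTop ℕ∞} {h : EuclideanSpace ℝ (Fin 3) → ℝ} (hh : ContDiff ℝ n h) :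
    ContDiff ℝ n (fun y => ‖y‖ ^ (2 * j + 2) * h y) := by
  have heq : (fun y : EuclideanSpace ℝ (Fin 3) => ‖y‖ ^ (2 * j + 2) * h y) =
      fun y => (‖y‖ ^ 2) ^ (j + 1) * h y := by
    funext y
    rw [← pow_mul, show 2 * (j + 1) = 2 * j + 2 by ring]
  rw [heq]
  exact ((contDiff_norm_sq ℝ).pow (j + 1)).mul hh

/-! ## (S3) The Hessian of a shell off the origin -/

/-- **(S3) Hessian of a shell at `x ≠ 0`**: for `h` of class `C²` at `x`,
`D²(‖·‖^α h)(x)(v)(w) = ‖x‖^α D²h(x)(v)(w) + α‖x‖^{α−2}(⟪x,v⟫Dh(x) w + ⟪x,w⟫Dh(x) v + h(x)⟪v,w⟫)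
 + α(α−2)‖x‖^{α−4} h(x)⟪x,v⟫⟪x,w⟫` (on the unit sphere `‖x‖ = 1` all radial powers are `1`). [folklore] -/
theorem fderiv_fderiv_norm_rpow_mul_apply (α : ℝ) {h : EuclideanSpace ℝ (Fin 3) → ℝ}
    {x : EuclideanSpace ℝ (Fin 3)} (hx : x ≠ 0) (hh : ContDiffAt ℝ 2 h x) (v w : EuclideanSpace ℝ (Fin 3)) :
    fderiv ℝ (fderiv ℝ (fun y => ‖y‖ ^ α * h y)) x v w =
      ‖x‖ ^ α * fderiv ℝ (fderiv ℝ h) x v w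
        + α * ‖x‖ ^ (α - 2) * (⟪x, v⟫ * fderiv ℝ h x w + ⟪x, w⟫ * fderiv ℝ h x v + h x * ⟪v, w⟫)
        + α * (α - 2) * ‖x‖ ^ (α - 4) * h x * ⟪x, v⟫ * ⟪x, w⟫ := by
  have hF2 : ContDiffAt ℝ 2 (fun y => ‖y‖ ^ α * h y) x := contDiffAt_norm_rpow_mul α hx hh
  rw [Literature.Analysis.PDE.LoewnerNirenberg.fderiv_fderiv_apply_eq_fderiv_apply
      (Literature.Analysis.PDE.LoewnerNirenberg.differentiableAt_fderiv_of_contDiffAt hF2) v w,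
    Literature.Analysis.PDE.LoewnerNirenberg.fderiv_fderiv_apply_eq_fderiv_apply
      (Literature.Analysis.PDE.LoewnerNirenberg.differentiableAt_fderiv_of_contDiffAt hh) v w]
  -- near `x` the first derivative along `w` is given by (S1)
  have hne : ∀ᶠ y in 𝓝 x, y ≠ 0 := isOpen_compl_singleton.eventually_mem hx
  have hdiff : ∀ᶠ y in 𝓝 x, DifferentiableAt ℝ h y :=
    Literature.Analysis.PDE.LoewnerNirenberg.eventually_differentiableAt_of_contDiffAt hh
  have heq : (fun y => fderiv ℝ (fun y => ‖y‖ ^ α * h y) y w) =ᶠ[𝓝 x]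
      fun y => ‖y‖ ^ α * fderiv ℝ h y w + α * ‖y‖ ^ (α - 2) * h y * ⟪w, y⟫ := by
    filter_upwards [hne, hdiff] with y hy hdy
    rw [fderiv_norm_rpow_mul_apply α hy hdy w, real_inner_comm y w]
  rw [heq.fderiv_eq]
  -- differentiate the explicit expression at `x`
  have h1 : HasFDerivAt (fun y : EuclideanSpace ℝ (Fin 3) => ‖y‖ ^ α)
      ((α * ‖x‖ ^ (α - 2)) • (innerSL ℝ x : EuclideanSpace ℝ (Fin 3) →L[ℝ] ℝ)) x :=
    hasFDerivAt_norm_rpow hx α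
  have h2 : HasFDerivAt (fun y : EuclideanSpace ℝ (Fin 3) => ‖y‖ ^ (α - 2))
      (((α - 2) * ‖x‖ ^ (α - 4)) • (innerSL ℝ x : EuclideanSpace ℝ (Fin 3) →L[ℝ] ℝ)) x := by
    have := hasFDerivAt_norm_rpow hx (α - 2)
    rwa [show α - 2 - 2 = α - 4 by ring] at this
  have h3 : HasFDerivAt (fun y => fderiv ℝ h y w) (fderiv ℝ (fun y => fderiv ℝ h y w) x) x :=
    ((Literature.Analysis.PDE.LoewnerNirenberg.differentiableAt_fderiv_of_contDiffAt hh).clm_apply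
      (differentiableAt_const w)).hasFDerivAt
  have h4 : HasFDerivAt h (fderiv ℝ h x) x := (hh.differentiableAt (by norm_num)).hasFDerivAt
  have h5 : HasFDerivAt (fun y : EuclideanSpace ℝ (Fin 3) => ⟪w, y⟫)
      (innerSL ℝ w : EuclideanSpace ℝ (Fin 3) →L[ℝ] ℝ) x :=
    (innerSL ℝ w : EuclideanSpace ℝ (Fin 3) →L[ℝ] ℝ).hasFDerivAt
  have hG := (h1.fun_mul h3).fun_add (((h2.const_mul α).fun_mul h4).fun_mul h5)
  rw [hG.fderiv]
  simp only [_root_.add_apply, FunLike.coe_smul, Pi.smul_apply,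
    innerSL_apply_apply, smul_eq_mul, real_inner_comm w x, real_inner_comm w v]
  ring

/-! ## (S4) Finite sums of shells -/

/-- The Laplacian of a finite sum of functions that are `C²` at `x` is the sum of the Laplacians. [folklore] -/
theorem laplacian_finset_sum_apply {ι : Type*} (s : Finset ι) {f : ι → EuclideanSpace ℝ (Fin 3) → ℝ}
    {x : EuclideanSpace ℝ (Fin 3)} (hf : ∀ k ∈ s, ContDiffAt ℝ 2 (f k) x) :
    Δ (fun y => ∑ k ∈ s, f k y) x = ∑ k ∈ s, Δ (f k) x := by
  classical
  induction s using Finset.induction_on with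
  | empty =>
    simp only [Finset.sum_empty]
    rw [congrFun (laplacian_eq_iteratedFDeriv_orthonormalBasis (fun _ : EuclideanSpace ℝ (Fin 3) => (0 : ℝ))
      (stdOrthonormalBasis ℝ (EuclideanSpace ℝ (Fin 3)))) x]
    simp [iteratedFDeriv_fun_zero]
  | insert a s ha ih =>
    have hfa : ContDiffAt ℝ 2 (f a) x := hf a (Finset.mem_insert_self a s)
    have hfs : ∀ k ∈ s, ContDiffAt ℝ 2 (f k) x := fun k hk => hf k (Finset.mem_insert_of_mem hk)
    have hsum : ContDiffAt ℝ 2 (fun y => ∑ k ∈ s, f k y) x := ContDiffAt.sum fun k hk => hfs k hk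
    simp only [Finset.sum_insert ha]
    have hadd := hfa.laplacian_add hsum
    have hfun : (f a + fun y => ∑ k ∈ s, f k y) = fun y => f a y + ∑ k ∈ s, f k y := by
      funext y
      simp
    rw [hfun] at hadd
    rw [hadd, ih hfs]

/-- **(S4) Laplacian of a finite sum of shells at `x ≠ 0`**: for shells `c k * ‖y‖ ^ α k * h k y` with each
`h k` of class `C²`, harmonic and Euler-homogeneous of degree `l k` at `x`,
`Δ(Σ_k c_k ‖·‖^{α_k} h_k)(x) = Σ_k c_k α_k(α_k + 2l_k + 1)‖x‖^{α_k−2} h_k(x)` (interior Fischer shells: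
`α_k = 2j_k + 2`; exterior Kelvin multipoles: `α_k = −(2l_k+1)`, every summand `0`). [folklore] -/
theorem laplacian_sum_norm_rpow_mul {ι : Type*} (s : Finset ι) (c α l : ι → ℝ)
    {h : ι → EuclideanSpace ℝ (Fin 3) → ℝ} {x : EuclideanSpace ℝ (Fin 3)} (hx : x ≠ 0)
    (hh : ∀ k ∈ s, ContDiffAt ℝ 2 (h k) x) (hΔ : ∀ k ∈ s, Δ (h k) x = 0)
    (hE : ∀ k ∈ s, ⟪x, gradient (h k) x⟫ = l k * h k x) :
    Δ (fun y => ∑ k ∈ s, c k * (‖y‖ ^ α k * h k y)) x =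
      ∑ k ∈ s, c k * (α k * (α k + 2 * l k + 1) * ‖x‖ ^ (α k - 2) * h k x) := by
  have hC : ∀ k ∈ s, ContDiffAt ℝ 2 (fun y => c k * (‖y‖ ^ α k * h k y)) x := fun k hk =>
    contDiffAt_const.mul (contDiffAt_norm_rpow_mul (α k) hx (hh k hk))
  rw [laplacian_finset_sum_apply s hC]
  refine Finset.sum_congr rfl fun k hk => ?_
  have hsm : (fun y => c k * (‖y‖ ^ α k * h k y)) = c k • fun y => ‖y‖ ^ α k * h k y := by
    funext y
    simp [smul_eq_mul]
  rw [hsm, InnerProductSpace.laplacian_smul (c k) (contDiffAt_norm_rpow_mul (α k) hx (hh k hk)),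
    smul_eq_mul, laplacian_norm_rpow_mul (α k) (l k) hx (hh k hk) (hΔ k hk) (hE k hk)]

/-- The derivative of a finite sum of shells at `x ≠ 0`, applied to `v` (Mathlib `fderiv_fun_sum` + (S1)).
[folklore] -/
theorem fderiv_sum_norm_rpow_mul_apply {ι : Type*} (s : Finset ι) (c α : ι → ℝ)
    {h : ι → EuclideanSpace ℝ (Fin 3) → ℝ} {x : EuclideanSpace ℝ (Fin 3)} (hx : x ≠ 0)
    (hh : ∀ k ∈ s, DifferentiableAt ℝ (h k) x) (v : EuclideanSpace ℝ (Fin 3)) :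
    fderiv ℝ (fun y => ∑ k ∈ s, c k * (‖y‖ ^ α k * h k y)) x v =
      ∑ k ∈ s, c k * (‖x‖ ^ α k * fderiv ℝ (h k) x v + α k * ‖x‖ ^ (α k - 2) * h k x * ⟪x, v⟫) := by
  have hd : ∀ k ∈ s, DifferentiableAt ℝ (fun y => c k * (‖y‖ ^ α k * h k y)) x := fun k hk =>
    (differentiableAt_const _).mul (hasFDerivAt_norm_rpow_mul (α k) hx (hh k hk).hasFDerivAt).differentiableAt
  rw [fderiv_fun_sum hd, FunLike.coe_sum, Finset.sum_apply]
  refine Finset.sum_congr rfl fun k hk => ?_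
  rw [fderiv_const_mul (hasFDerivAt_norm_rpow_mul (α k) hx (hh k hk).hasFDerivAt).differentiableAt,
    FunLike.coe_smul, Pi.smul_apply, smul_eq_mul, fderiv_norm_rpow_mul_apply (α k) hx (hh k hk) v]

/-- The second derivative of a finite sum of functions that are `C²` at `x` is the sum of the second
derivatives (applied form). [folklore] -/
theorem fderiv_fderiv_finset_sum_apply {ι : Type*} (s : Finset ι) {f : ι → EuclideanSpace ℝ (Fin 3) → ℝ}
    {x : EuclideanSpace ℝ (Fin 3)} (hf : ∀ k ∈ s, ContDiffAt ℝ 2 (f k) x) (v w : EuclideanSpace ℝ (Fin 3)) :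
    fderiv ℝ (fderiv ℝ (fun y => ∑ k ∈ s, f k y)) x v w = ∑ k ∈ s, fderiv ℝ (fderiv ℝ (f k)) x v w := by
  have hsum : ContDiffAt ℝ 2 (fun y => ∑ k ∈ s, f k y) x := ContDiffAt.sum fun k hk => hf k hk
  rw [Literature.Analysis.PDE.LoewnerNirenberg.fderiv_fderiv_apply_eq_fderiv_apply
      (Literature.Analysis.PDE.LoewnerNirenberg.differentiableAt_fderiv_of_contDiffAt hsum) v w]
  -- near `x` every summand is differentiable, so the first derivative is the sum of the derivatives
  have hev : ∀ᶠ y in 𝓝 x, ∀ k ∈ s, DifferentiableAt ℝ (f k) y :=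
    (Filter.eventually_all_finset s).2 fun k hk =>
      Literature.Analysis.PDE.LoewnerNirenberg.eventually_differentiableAt_of_contDiffAt (hf k hk)
  have heq : (fun y => fderiv ℝ (fun y => ∑ k ∈ s, f k y) y w) =ᶠ[𝓝 x]
      fun y => ∑ k ∈ s, fderiv ℝ (f k) y w := by
    filter_upwards [hev] with y hy
    rw [fderiv_fun_sum hy, FunLike.coe_sum, Finset.sum_apply]
  rw [heq.fderiv_eq]
  have hd : ∀ k ∈ s, DifferentiableAt ℝ (fun y => fderiv ℝ (f k) y w) x := fun k hk =>
    (Literature.Analysis.PDE.LoewnerNirenberg.differentiableAt_fderiv_of_contDiffAt (hf k hk)).clm_apply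
      (differentiableAt_const w)
  rw [fderiv_fun_sum hd, FunLike.coe_sum, Finset.sum_apply]
  refine Finset.sum_congr rfl fun k hk => ?_
  rw [Literature.Analysis.PDE.LoewnerNirenberg.fderiv_fderiv_apply_eq_fderiv_apply
      (Literature.Analysis.PDE.LoewnerNirenberg.differentiableAt_fderiv_of_contDiffAt (hf k hk)) v w]

/-- **(S4, Hessian)** The Hessian of a finite sum of shells `Σ_k ‖·‖^{α_k} h_k` at `x ≠ 0`, applied to `(v,w)`,
for `h_k` of class `C²` at `x` (constant coefficients are folded into the `h_k`): the sum of the (S3) Hessians.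
[folklore] -/
theorem fderiv_fderiv_sum_norm_rpow_mul_apply {ι : Type*} (s : Finset ι) (α : ι → ℝ)
    {h : ι → EuclideanSpace ℝ (Fin 3) → ℝ} {x : EuclideanSpace ℝ (Fin 3)} (hx : x ≠ 0)
    (hh : ∀ k ∈ s, ContDiffAt ℝ 2 (h k) x) (v w : EuclideanSpace ℝ (Fin 3)) :
    fderiv ℝ (fderiv ℝ (fun y => ∑ k ∈ s, ‖y‖ ^ α k * h k y)) x v w =
      ∑ k ∈ s, (‖x‖ ^ α k * fderiv ℝ (fderiv ℝ (h k)) x v w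
        + α k * ‖x‖ ^ (α k - 2) * (⟪x, v⟫ * fderiv ℝ (h k) x w + ⟪x, w⟫ * fderiv ℝ (h k) x v + h k x * ⟪v, w⟫)
        + α k * (α k - 2) * ‖x‖ ^ (α k - 4) * h k x * ⟪x, v⟫ * ⟪x, w⟫) := by
  rw [fderiv_fderiv_finset_sum_apply s (fun k hk => contDiffAt_norm_rpow_mul (α k) hx (hh k hk)) v w]
  exact Finset.sum_congr rfl fun k hk => fderiv_fderiv_norm_rpow_mul_apply (α k) hx (hh k hk) v w

end Summit.NavierStokesRegularity.NavierStokesRegularity.Theorems.StrainDoors.HarmonicShell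

end
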